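import Literature.AlgebraicGeometry.Resolution.QuadraticTransforms
import Mathlib.RingTheory.Valuation.LocalSubring
import Mathlib.Data.Set.Card
import Mathlib.Algebra.BigOperators.Group.Finset.Basic
import HarnessLib

/-!
# The tree of iterated quadratic transforms and the base points of a vector of functions

Topic: `Literature/AlgebraicGeometry/Resolution`. Zariski–Samuel II, Appendix 5 and Zariski 1944
(reduction of singularities of surfaces; the "base points, including infinitely near ones" of a
linear system on a regular two-dimensional local scheme): for a local ring `R` of the field `K`
the ITERATED QUADRATIC TRANSFORMS of `R` (`Relation.ReflTransGen IsQuadraticTransform`,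
`QuadraticTransforms.lean`; Cutkosky 2014, §2.1) form a rooted tree — every iterated transform
other than `R` lies above exactly one (first) quadratic transform of `R`
(`IsQuadraticTransform.eq_of_dominated`: two quadratic transforms of `R` dominated by a common
local ring coincide, by uniqueness of the transform along a valuation). For a vector
`w = (w₀, …, wₙ)` of elements of `K` (homogeneous coordinates of a rational map to `ℙⁿ`) the
predicate `DefinedOn w 𝔬` — some `wᵢ ≠ 0` with all `w_l/wᵢ ∈ 𝔬` — says that the map is defined at
the local ring `𝔬`; it is monotone, and automatic on valuation rings. The **base tree**
`baseTree R w` is the set of iterated quadratic transforms of `R` at which `w` is NOT defined (the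
base points of the map on the tower of point blowing ups of `Spec R`, infinitely near ones
included), and `baseCount R w` its cardinality. PROVED here (pure commutative algebra inside `K`):

* `IsQuadraticTransform.ne`, `IsQuadraticTransform.eq_of_dominated`, the decomposition
  `reflTransGen_iff_eq_or_exists_head` of the tree through the first transforms;
* `DefinedOn.mono`, `definedOn_valuationSubring`;
* `mem_baseTree_cases` (decomposition through the first transforms) and **`sum_baseCount_add_one_le`**: if `w` is
  not defined at `R` and the base tree of `R` is finite then, for any finite set `F` of (distinct)
  quadratic transforms of `R`, `∑_{R₁ ∈ F} baseCount R₁ w + 1 ≤ baseCount R w` — Zariski's count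
  "`N_{η'} = N_η − 1`" behind the termination of his bad-point induction (Piltant 2013, Lemma 5.6).

Finiteness of the base tree (for `R` regular of dimension two) is proved in a later file.

## References

* O. Zariski, P. Samuel, *Commutative Algebra* II (1960), Appendix 5. [ZariskiSamuel1960]
* S. D. Cutkosky, Math. Ann. 362 (2015) (arXiv:1404.7459), §2.1–2.2, Thm. 2.1. [Cutkosky2014]
* O. Piltant, RACSAM 107 (2013), proof of Prop. 5.1, Lemmas 5.3 and 5.6. [Piltant2013]
-/

noncomputable section

open IsLocalRing

namespace Literature.AlgebraicGeometry.Resolution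

universe u

variable {K : Type u} [Field K]

/-! ## Quadratic transforms are proper extensions; uniqueness of the dominated transform -/

/-- **A quadratic transform of a local ring whose maximal ideal is not principal is a proper
extension** (`y/x ∈ R₁ ∖ R` for `y ∈ 𝔪_R ∖ xR`). [cite: Cutkosky2014, §2.1] -/
theorem IsQuadraticTransform.ne {R R₁ : Subring K} (h : IsQuadraticTransform R R₁)
    (hm : ∀ (hR : IsLocalRing R) (z : R), @maximalIdeal R _ hR ≠ Ideal.span {z}) : R ≠ R₁ := by
  obtain ⟨hR, x, hx, hx0, -, hT, -, -⟩ := h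
  intro heq
  have hle : R₁ ≤ R := heq ▸ le_rfl
  apply hm hR x
  refine le_antisymm (fun y hy => ?_) ((Ideal.span_singleton_le_iff_mem _).mpr hx)
  -- `y/x ∈ R₁ = R`, so `y = (y/x) x ∈ (x)`
  have hyx : (y : K) / x ∈ R := hle (hT (div_mem_blowupRing _ hy))
  have hx0' : ((x : R) : K) ≠ 0 := fun e => hx0 (Subtype.ext e)
  refine Ideal.mem_span_singleton'.mpr ⟨⟨(y : K) / x, hyx⟩, Subtype.ext ?_⟩
  change (y : K) / x * x = y
  rw [div_mul_cancel₀ _ hx0']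

/-- **Two quadratic transforms of `R` dominated by a common local ring coincide** (Abhyankar 1956;
Cutkosky 2014, Thm. 2.1, uniqueness): a valuation ring `𝒪` dominating the common dominating ring
dominates both, both are then the transform of `R` along `𝒪`, which is unique
(`IsQuadraticTransformAlong.unique`). Requires `𝔪_R` finitely generated. [cite: Cutkosky2014, Thm. 2.1] -/
theorem IsQuadraticTransform.eq_of_dominated {R R₁ R₂ S : Subring K} [IsLocalRing S]
    (h₁ : IsQuadraticTransform R R₁) (h₂ : IsQuadraticTransform R R₂)
    (hfg : ∃ _ : IsLocalRing R, (maximalIdeal R).FG)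
    (hS₁ : SubringDominates R₁ S) (hS₂ : SubringDominates R₂ S) : R₁ = R₂ := by
  obtain ⟨V, hV⟩ := (LocalSubring.mk S).exists_le_valuationSubring
  haveI : IsLocalRing V.toSubring := inferInstanceAs (IsLocalRing V)
  have hSV : SubringDominates S V.toSubring := (subringDominates_iff S V.toSubring).mpr hV
  haveI := h₁.isLocalRing
  haveI := h₂.isLocalRing
  exact (h₁.along hfg (hS₁.trans hSV)).unique (h₂.along hfg (hS₂.trans hSV))

/-! ## The tree of iterated quadratic transforms -/

/-- An iterated quadratic transform of `R` other than `R` lies above a (first) quadratic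
transform of `R`. [folklore] -/
theorem reflTransGen_iff_eq_or_exists_head {R S : Subring K} :
    Relation.ReflTransGen IsQuadraticTransform R S ↔
      S = R ∨ ∃ R₁, IsQuadraticTransform R R₁ ∧ Relation.ReflTransGen IsQuadraticTransform R₁ S := by
  constructor
  · intro h
    rcases Relation.ReflTransGen.cases_head h with rfl | ⟨R₁, h₁, h₂⟩
    · exact Or.inl rfl
    · exact Or.inr ⟨R₁, h₁, h₂⟩
  · rintro (rfl | ⟨R₁, h₁, h₂⟩)
    · exact Relation.ReflTransGen.refl
    · exact Relation.ReflTransGen.head h₁ h₂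

/-- Iterated quadratic transforms are local rings. [folklore] -/
theorem isLocalRing_of_reflTransGen {R S : Subring K} [hR : IsLocalRing R]
    (h : Relation.ReflTransGen IsQuadraticTransform R S) : IsLocalRing S := by
  induction h with
  | refl => exact hR
  | tail _ hq _ => exact hq.isLocalRing

/-- `R` is not an iterated quadratic transform of one of its own quadratic transforms (when `𝔪_R`
is not principal). [folklore] -/
theorem not_reflTransGen_of_isQuadraticTransform {R R₁ : Subring K} (h₁ : IsQuadraticTransform R R₁)
    (hm : ∀ (hR : IsLocalRing R) (z : R), @maximalIdeal R _ hR ≠ Ideal.span {z}) :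
    ¬ Relation.ReflTransGen IsQuadraticTransform R₁ R := fun h =>
  h₁.ne hm (le_antisymm h₁.dominates.1 (subringDominates_of_reflTransGen h).1)

/-- **The first quadratic transform below an iterated one is unique**: if `S` is an iterated
quadratic transform of both `R₁` and `R₂`, quadratic transforms of `R`, then `R₁ = R₂`.
[cite: Cutkosky2014, Thm. 2.1] -/
theorem IsQuadraticTransform.eq_of_reflTransGen {R R₁ R₂ S : Subring K} [IsLocalRing R]
    (h₁ : IsQuadraticTransform R R₁) (h₂ : IsQuadraticTransform R R₂) (hfg : (maximalIdeal R).FG)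
    (hS₁ : Relation.ReflTransGen IsQuadraticTransform R₁ S)
    (hS₂ : Relation.ReflTransGen IsQuadraticTransform R₂ S) : R₁ = R₂ := by
  haveI := h₁.isLocalRing
  haveI : IsLocalRing S := isLocalRing_of_reflTransGen hS₁
  exact h₁.eq_of_dominated h₂ ⟨‹_›, hfg⟩ (subringDominates_of_reflTransGen hS₁)
    (subringDominates_of_reflTransGen hS₂)

/-! ## Where a vector of elements of `K` is defined -/

/-- **`w = (w₀, …, wₙ)` is defined on the subring `𝔬 ⊆ K`**: for some `i`, `wᵢ ≠ 0` and all
`w_l/wᵢ` lie in `𝔬` (the rational map `(w₀ : … : wₙ)` to `ℙⁿ` is a morphism at `Spec 𝔬`;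
Zariski–Samuel II, Ch. VI §17; Hartshorne II 7.1). [cite: ZariskiSamuel1960, Ch. VI §17] -/
def DefinedOn {n : ℕ} (w : Fin (n + 1) → K) (O : Subring K) : Prop :=
  ∃ i, w i ≠ 0 ∧ ∀ l, w l / w i ∈ O

/-- `DefinedOn` is monotone in the subring. [folklore] -/
theorem DefinedOn.mono {n : ℕ} {w : Fin (n + 1) → K} {O O' : Subring K} (h : DefinedOn w O)
    (hle : O ≤ O') : DefinedOn w O' := by
  obtain ⟨i, hi, hl⟩ := h
  exact ⟨i, hi, fun l => hle (hl l)⟩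

/-- A non-zero vector is defined on `K` itself. [folklore] -/
theorem definedOn_top {n : ℕ} {w : Fin (n + 1) → K} (hw : ∃ i, w i ≠ 0) : DefinedOn w ⊤ := by
  obtain ⟨i, hi⟩ := hw
  exact ⟨i, hi, fun _ => Subring.mem_top _⟩

/-- **A non-zero vector is defined on every valuation ring of `K`**: take `i` with `v(wᵢ)`
maximal (valuative criterion for `ℙⁿ`, Hartshorne II 7.1 / 4.7). [cite: Hartshorne1977, II Thm. 7.1] -/
theorem definedOn_valuationSubring {n : ℕ} {w : Fin (n + 1) → K} (hw : ∃ i, w i ≠ 0)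
    (V : ValuationSubring K) : DefinedOn w V.toSubring := by
  classical
  obtain ⟨i, -, hi⟩ := Finset.exists_max_image Finset.univ (fun l => V.valuation (w l))
    ⟨hw.choose, Finset.mem_univ _⟩
  have hi0 : w i ≠ 0 := by
    intro h0
    obtain ⟨j, hj⟩ := hw
    have := hi j (Finset.mem_univ j)
    rw [h0, map_zero, le_zero_iff, map_eq_zero] at this
    exact hj this
  refine ⟨i, hi0, fun l => ?_⟩
  change w l / w i ∈ V
  rw [← V.valuation_le_one_iff, map_div₀]
  exact div_le_one_of_le₀ (hi l (Finset.mem_univ l)) zero_le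

/-! ## The base tree and the base count -/

/-- **The base tree** of the vector `w` above the local ring `R` of `K`: the iterated quadratic
transforms of `R` at which `(w₀ : … : wₙ)` is NOT defined — the base points of the rational map on
the tower of point blowing ups of `Spec R`, infinitely near ones included (Zariski–Samuel II,
App. 5; Zariski 1944). [cite: ZariskiSamuel1960, Appendix 5] -/
def baseTree {n : ℕ} (R : Subring K) (w : Fin (n + 1) → K) : Set (Subring K) :=
  {S | Relation.ReflTransGen IsQuadraticTransform R S ∧ ¬ DefinedOn w S}

/-- **The base count** `μ(R, w)`: the number of base points of `w` above `R`, infinitely near ones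
included (`0` if infinite). [cite: ZariskiSamuel1960, Appendix 5] -/
def baseCount {n : ℕ} (R : Subring K) (w : Fin (n + 1) → K) : ℕ :=
  (baseTree R w).ncard

variable {n : ℕ}

/-- Membership in the base tree. [folklore] -/
theorem mem_baseTree_iff {R S : Subring K} {w : Fin (n + 1) → K} :
    S ∈ baseTree R w ↔ Relation.ReflTransGen IsQuadraticTransform R S ∧ ¬ DefinedOn w S := Iff.rfl

/-- `R` lies in its own base tree iff `w` is not defined on `R`. [folklore] -/
theorem self_mem_baseTree_iff {R : Subring K} {w : Fin (n + 1) → K} :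
    R ∈ baseTree R w ↔ ¬ DefinedOn w R :=
  ⟨fun h => h.2, fun h => ⟨Relation.ReflTransGen.refl, h⟩⟩

/-- If `w` is defined on `R` its base tree is empty (definedness persists upwards, every iterated
transform containing `R`). [folklore] -/
theorem baseTree_eq_empty_of_definedOn {R : Subring K} {w : Fin (n + 1) → K} (h : DefinedOn w R) :
    baseTree R w = ∅ := by
  ext S
  simp only [mem_baseTree_iff, Set.mem_empty_iff_false, iff_false, not_and, not_not]
  exact fun hS => h.mono (subringDominates_of_reflTransGen hS).1

/-- Hence the base count vanishes where `w` is defined. [folklore] -/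
theorem baseCount_eq_zero_of_definedOn {R : Subring K} {w : Fin (n + 1) → K} (h : DefinedOn w R) :
    baseCount R w = 0 := by
  rw [baseCount, baseTree_eq_empty_of_definedOn h, Set.ncard_empty]

/-- The base tree of a quadratic transform is contained in that of `R`. [folklore] -/
theorem baseTree_subset_of_isQuadraticTransform {R R₁ : Subring K} {w : Fin (n + 1) → K}
    (h₁ : IsQuadraticTransform R R₁) : baseTree R₁ w ⊆ baseTree R w := fun _ hS =>
  ⟨Relation.ReflTransGen.head h₁ hS.1, hS.2⟩

/-- **Decomposition of the base tree through the first quadratic transforms**: a member of the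
base tree of `R` is `R` itself or lies in the base tree of a quadratic transform of `R`.
[cite: ZariskiSamuel1960, Appendix 5] -/
theorem mem_baseTree_cases {R S : Subring K} {w : Fin (n + 1) → K} (hS : S ∈ baseTree R w) :
    S = R ∨ ∃ R₁, IsQuadraticTransform R R₁ ∧ S ∈ baseTree R₁ w := by
  rcases reflTransGen_iff_eq_or_exists_head.mp hS.1 with rfl | ⟨R₁, h₁, h₂⟩
  · exact Or.inl rfl
  · exact Or.inr ⟨R₁, h₁, h₂, hS.2⟩

/-- A positive base count at `R` when `w` is not defined there (and the tree is finite).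
[folklore] -/
theorem one_le_baseCount {R : Subring K} {w : Fin (n + 1) → K} (h : ¬ DefinedOn w R)
    (hfin : (baseTree R w).Finite) : 1 ≤ baseCount R w := by
  rw [baseCount, Nat.one_le_iff_ne_zero, Ne, Set.ncard_eq_zero hfin]
  exact fun he => by simpa [he] using self_mem_baseTree_iff.mpr h

/-- **Zariski's count `N_{η'} = N_η − 1`** (Piltant 2013, proof of Lemma 5.6; Zariski–Samuel II,
App. 5): if `w` is not defined on the local ring `R` (with `𝔪_R` finitely generated and not
principal) and the base tree of `R` is finite then, for every finite set `F` of quadratic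
transforms of `R`, `∑_{R₁ ∈ F} μ(R₁, w) + 1 ≤ μ(R, w)` — the base trees of distinct first
transforms are disjoint subsets of the base tree of `R`, which also contains `R`.
[cite: Piltant2013, Lemma 5.6 (proof)] -/
theorem sum_baseCount_add_one_le {R : Subring K} [IsLocalRing R] {w : Fin (n + 1) → K}
    (hfg : (maximalIdeal R).FG) (hm : ∀ z : R, maximalIdeal R ≠ Ideal.span {z})
    (h : ¬ DefinedOn w R) (hfin : (baseTree R w).Finite) (F : Finset (Subring K))
    (hF : ∀ R₁ ∈ F, IsQuadraticTransform R R₁) :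
    ∑ R₁ ∈ F, baseCount R₁ w + 1 ≤ baseCount R w := by
  classical
  have hm' : ∀ (hR : IsLocalRing R) (z : R), @maximalIdeal R _ hR ≠ Ideal.span {z} := fun _ z => hm z
  -- the union of the base trees of the members of `F`, a subset of `baseTree R w ∖ {R}`
  have hsub : ∀ R₁ ∈ F, baseTree R₁ w ⊆ baseTree R w \ {R} := fun R₁ hR₁ S hS =>
    ⟨baseTree_subset_of_isQuadraticTransform (hF R₁ hR₁) hS, fun hSR => by
      rw [Set.mem_singleton_iff] at hSR
      subst hSR
      exact not_reflTransGen_of_isQuadraticTransform (hF R₁ hR₁) hm' hS.1⟩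
  have hdisj : ∀ R₁ ∈ F, ∀ R₂ ∈ F, R₁ ≠ R₂ → Disjoint (baseTree R₁ w) (baseTree R₂ w) := by
    intro R₁ hR₁ R₂ hR₂ hne
    refine Set.disjoint_left.mpr fun S hS₁ hS₂ => hne ?_
    exact (hF R₁ hR₁).eq_of_reflTransGen (hF R₂ hR₂) hfg hS₁.1 hS₂.1
  have hfinU : ∀ R₁ ∈ F, (baseTree R₁ w).Finite := fun R₁ hR₁ =>
    hfin.subset ((hsub R₁ hR₁).trans Set.sdiff_subset)
  -- counting with finsets inside the finite set `T = baseTree R w`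
  set T : Finset (Subring K) := hfin.toFinset with hT
  have hTcard : baseCount R w = T.card := Set.ncard_eq_toFinset_card _ hfin
  let t : Subring K → Finset (Subring K) := fun R₁ => T.filter (· ∈ baseTree R₁ w)
  have ht : ∀ R₁ ∈ F, ((t R₁ : Finset (Subring K)) : Set (Subring K)) = baseTree R₁ w := by
    intro R₁ hR₁
    ext S
    simp only [t, Finset.coe_filter, Set.Finite.mem_toFinset, Set.mem_setOf_eq, hT]
    exact ⟨fun hS => hS.2, fun hS => ⟨(hsub R₁ hR₁ hS).1, hS⟩⟩
  have htcard : ∀ R₁ ∈ F, baseCount R₁ w = (t R₁).card := fun R₁ hR₁ => by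
    rw [baseCount, ← ht R₁ hR₁, Set.ncard_coe_finset]
  have hdisj' : (F : Set (Subring K)).PairwiseDisjoint t := by
    intro R₁ hR₁ R₂ hR₂ hne
    rw [Function.onFun, Finset.disjoint_coe.symm, ht R₁ hR₁, ht R₂ hR₂]
    exact hdisj R₁ hR₁ R₂ hR₂ hne
  have hsum : ∑ R₁ ∈ F, baseCount R₁ w = (F.biUnion t).card := by
    rw [Finset.card_biUnion hdisj']
    exact Finset.sum_congr rfl htcard
  have hRT : R ∈ T := by
    rw [hT, Set.Finite.mem_toFinset]; exact self_mem_baseTree_iff.mpr h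
  have hle : F.biUnion t ⊆ T.erase R := by
    intro S hS
    obtain ⟨R₁, hR₁, hS⟩ := Finset.mem_biUnion.mp hS
    have hS' : S ∈ baseTree R₁ w := by rw [← ht R₁ hR₁]; exact hS
    obtain ⟨h1, h2⟩ := hsub R₁ hR₁ hS'
    exact Finset.mem_erase.mpr ⟨fun e => h2 (Set.mem_singleton_iff.mpr e),
      by rw [hT, Set.Finite.mem_toFinset]; exact h1⟩
  have hcard := Finset.card_le_card hle
  rw [Finset.card_erase_of_mem hRT] at hcard
  rw [hsum, hTcard]
  have hpos : 0 < T.card := Finset.card_pos.mpr ⟨R, hRT⟩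
  omega

end Literature.AlgebraicGeometry.Resolution

end
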